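import Literature.MathematicalPhysics.QuantumFieldTheory.Balaban1983to89.Beta.WindowInterface

/-!
# Beta/WindowIdentification — the (W3b) identification binder of the window interface reduces to a bound on
`β⁰(L,k) − FULLSUM_w K_{L,k}(w)`; the full lattice sum exists by (W3a)'s own decay hypothesis

HONEST FRAMING (cell `pub-balaban`, β sub-cell, row an2 = the background-field / log-det route; HOME/BETA/AN2.md §10;
BETA-SPEC RULING (R8): the (W3b) IDENTIFICATION is owned by the an2 lineage).  The β sub-cell tries to discharge the
one-loop input `FlowStep.BetaPertH` of [Balaban1987RG1] Theorem 2; discharging it would make Bałaban's ultraviolet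
STABILITY theorem unconditional — a constructive-QFT statement that is NOT the continuum limit and NOT the Clay problem —
and this file is not even that: it is bookkeeping about partial sums over the punctured sup-norm balls of `ℤ⁴`.
Value = a typed checklist for one binder of `Beta.WindowInterface`, NOT summit progress.

WHAT IS IN PRINT (context, cited by number; the manuscripts are the object of the audit and are not used as facts).
[Balaban1987RG1] p. 264 (1.21)–(1.22): «Π^{ab}_{j+1,μν}(g_j,x,x′) = δ^{ab}Π_{j+1,μν}(g_j, x − x′)», «Now we take a limit
of these functions as T^{(j+1)} ↗ Z^d», «β_{j+1}(g_j) = … = Σ_x Π_{j+1,μν}(g_j, x)x_μx_ν for μ, ν arbitrary, μ ≠ ν»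
— the coefficient is a FULL lattice sum over `ℤ^d` of a summable kernel times `x_μx_ν` (the point `x = 0` contributes
nothing since `x_μx_ν = 0` there, so the punctured sums below lose nothing).

WHAT THIS FILE PROVES (all [folklore]).  `Beta.WindowInterface` (RULING (R8), §7–§8) reads the (W3) binder of the wall
`LargeLWindow.WindowDecomposition` as (W3a) a shellwise scale-`L` exponential bound on the actual integrand `K_{L,k}`
beyond the window + (W3b) `hident : ∀ L ≥ 2, ∀ k, ∃ R ≥ M(L), |β⁰(L,k) − Σ_{0<‖w‖∞≤R} K_{L,k}(w)| ≤ U`.  Here: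
* §1 partial sums `psum K R = Σ_{0<‖w‖∞≤R} K(w)` and their telescoping over annuli;
* §2 under (W3a)'s OWN hypothesis at fixed `(L,k)` (`|K(w)| ≤ E(r+1)⁻⁴e^{−(δ/L)(r+1)}` on the shells `r ≥ M`) the partial
  sums form a Cauchy sequence (`cauchySeq_psum_of_shellBound`, tail `≤ 80E(1+L/δ)/(R+1)` from
  `WindowInterface.tail_sum_le_exp`), hence converge to `fullSum K := limUnder atTop (psum K)` with the quantitative rate
  `|fullSum K − psum K R| ≤ 80E(1+L/δ)/(R+1)` for `R ≥ M` (`abs_fullSum_sub_psum_le`);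
* §3 consequently (W3b) FOLLOWS, with `U + ε` for any `ε > 0`, from the honest analytic statement
  (W3b′) `∀ L ≥ 2, ∀ k, |β⁰(L,k) − fullSum K_{L,k}| ≤ U` (`hident_of_fullSum`), and CONVERSELY (W3b) gives (W3b′) back with
  `U + 80E(1 + c/δ)` under the wall's window comparability (`fullSumIdent_of_hident`) — the two are one statement up to the
  additive constant of the `A₁` slot; the composites
  `windowDecomposition_of_fullSumInterface` / `windowDecomposition_of_legFullSumInterface` are
  `WindowInterface.windowDecomposition_of_splitInterface` / `…of_legSplitInterface` with `hident` replaced by (W3b′);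
* §4 for a SUMMABLE kernel `fullSum K = Σ' w, K w − K 0` (`fullSum_eq_tsum_sub`, exhaustion of `ℤ⁴` by the balls), hence the
  BRIDGE TO THE TREE'S (1.22): `B12Beta.secondMoment Π μ ν = fullSum (x ↦ Π_{μν}(x)x_μx_ν)` whenever the integrand is
  summable (`secondMoment_eq_fullSum`; the origin has weight `0`);
* §5 the algebra of (W3b′) for a kernel assembled from PIECES: `fullSum` is additive and homogeneous on convergent pieces
  (`fullSum_add`, `fullSum_const_mul`), equals a finite partial sum on finitely supported pieces (`fullSum_of_support`), and
  a piece of `β⁰` with NO leg-product counterpart enters `U` by the triangle inequality (`ident_of_pieces`).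
READING for the an2 row (AN2.md §10.11–§10.12): (W3b′) says that `β⁰(L,k)` minus the full `(1.22)`-moment of the
LEG-PRODUCT part `w_μw_ν Σ_i c_i F′_i G′_i` of Bałaban's polarization is `(L,k)`-bounded; its inputs are exactly the
row's typed items — the finitely supported CONTACT table (`Beta.BubbleTable.contact_stencil`, coefficients to be bounded
uniformly in `(L,k)`), the unit-sector pieces, and the minimizer-dressing cross terms (β-st-J)
(`Beta.MomentFactorisation.M2_dressed_ward`) — while the existence of the full sum and the passage from `∃ R` to the limit
cost nothing.  Nothing here asserts that Bałaban's `β⁰` satisfies (W3b′): that is the open analytic content.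

References (CONTEXT ONLY; nothing in this file is cited as a fact): T. Bałaban, Renormalization group approach to lattice
gauge field theories. I, Commun. Math. Phys. 109 (1987) 249–301 [Balaban1987RG1] ((1.20)–(1.22) p. 264).
Provenance: β sub-cell row an2 gen 3 (planner seat), journal claim BETA-an2-IDENT; staged byte-identically under
`HOME/lean/BalabanYm4/`.  NOT summit progress.
-/

namespace Literature.MathematicalPhysics.QuantumFieldTheory.Balaban1983to89.Beta.WindowIdentification

open Finset Filter Topology
open Literature.Probability.LatticeModels (annulus)
open Literature.MathematicalPhysics.QuantumFieldTheory.Balaban1983to89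
open Literature.MathematicalPhysics.QuantumFieldTheory.Balaban1983to89.Beta
open Literature.MathematicalPhysics.QuantumFieldTheory.Balaban1983to89.Beta.TransverseStructure (E4)
open Literature.MathematicalPhysics.QuantumFieldTheory.Balaban1983to89.Beta.LeadingCoefficient (leadingIntegrand)
open Literature.MathematicalPhysics.QuantumFieldTheory.Balaban1983to89.Beta.DyadicShell (Pt toReal supNorm
  sum_Ico_shellSum mem_annulus_iff)
open Literature.MathematicalPhysics.QuantumFieldTheory.Balaban1983to89.Beta.LargeLWindow (WindowDecomposition)
open Literature.MathematicalPhysics.QuantumFieldTheory.Balaban1983to89.Beta.BubbleTransfer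
open Literature.MathematicalPhysics.QuantumFieldTheory.Balaban1983to89.Beta.WindowInterface

noncomputable section

/-! ## 1. Partial sums over the punctured sup-norm balls -/

/-- The partial sum `Σ_{0<‖w‖∞≤R} K(w)` over the punctured ball (the tree's `annulus 4 0 R`). [folklore] -/
def psum (K : Pt → ℝ) (R : ℕ) : ℝ := ∑ w ∈ annulus 4 0 R, K w

/-- Unfolding `psum`. [folklore] -/
theorem psum_def (K : Pt → ℝ) (R : ℕ) : psum K R = ∑ w ∈ annulus 4 0 R, K w := rfl

/-- Telescoping: `psum K R′ − psum K R = Σ_{R<‖w‖∞≤R′} K` for `R ≤ R′`. [folklore] -/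
theorem psum_sub_psum (K : Pt → ℝ) {R R' : ℕ} (h : R ≤ R') :
    psum K R' - psum K R = ∑ w ∈ annulus 4 R R', K w := by
  rw [psum, psum, ← sum_Ico_shellSum _ (Nat.zero_le R'), ← sum_Ico_shellSum _ (Nat.zero_le R), ← sum_Ico_shellSum _ h,
    ← Finset.sum_Ico_consecutive _ (Nat.zero_le R) h]
  ring

/-- `psum` is additive in the kernel. [folklore] -/
theorem psum_add (K₁ K₂ : Pt → ℝ) (R : ℕ) : psum (fun w => K₁ w + K₂ w) R = psum K₁ R + psum K₂ R := by
  rw [psum, psum, psum, Finset.sum_add_distrib]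

/-- `psum` is homogeneous in the kernel. [folklore] -/
theorem psum_const_mul (a : ℝ) (K : Pt → ℝ) (R : ℕ) : psum (fun w => a * K w) R = a * psum K R := by
  rw [psum, psum, Finset.mul_sum]

/-- A kernel vanishing beyond sup-radius `R₁` has constant partial sums from `R₁` on. [folklore] -/
theorem psum_eq_of_support {K : Pt → ℝ} {R₁ : ℕ} (hK : ∀ w : Pt, R₁ < supNorm w → K w = 0) {R : ℕ} (hR : R₁ ≤ R) :
    psum K R = psum K R₁ := by
  have h := psum_sub_psum K hR
  have h0 : ∑ w ∈ annulus 4 R₁ R, K w = 0 :=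
    Finset.sum_eq_zero fun w hw => hK w (mem_annulus_iff.mp hw).1
  linarith

/-! ## 2. Under (W3a)'s shellwise decay the partial sums converge: the full lattice sum -/

section Limit

variable {K : Pt → ℝ} {E δ Lr : ℝ} {M : ℕ}

/-- The tail bound of `WindowInterface.tail_sum_le_exp` in `psum` form: for `M ≤ R ≤ R′`,
`|psum K R′ − psum K R| ≤ 80E(1 + L/δ)/(R+1)`. [folklore] -/
theorem abs_psum_sub_psum_le (hE : 0 ≤ E) (hδ : 0 < δ) (hL : 0 < Lr)
    (h : ∀ r : ℕ, M ≤ r → ∀ w ∈ annulus 4 r (r + 1),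
      |K w| ≤ E / ((r : ℝ) + 1) ^ 4 * Real.exp (-(δ / Lr) * ((r : ℝ) + 1)))
    {R R' : ℕ} (hMR : M ≤ R) (hRR' : R ≤ R') :
    |psum K R' - psum K R| ≤ 80 * E * (1 + Lr / δ) / ((R : ℝ) + 1) := by
  rw [psum_sub_psum K hRR']
  exact tail_sum_le_exp hE hδ hL hRR' fun r hr w hw => h r (le_trans hMR hr) w hw

/-- **The partial sums are Cauchy** under the shellwise scale-`L` exponential bound beyond `M`. [folklore] -/
theorem cauchySeq_psum_of_shellBound (hE : 0 ≤ E) (hδ : 0 < δ) (hL : 0 < Lr)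
    (h : ∀ r : ℕ, M ≤ r → ∀ w ∈ annulus 4 r (r + 1),
      |K w| ≤ E / ((r : ℝ) + 1) ^ 4 * Real.exp (-(δ / Lr) * ((r : ℝ) + 1))) :
    CauchySeq (psum K) := by
  refine Metric.cauchySeq_iff'.mpr fun ε hε => ?_
  set T : ℝ := 80 * E * (1 + Lr / δ) with hT
  have hT0 : 0 ≤ T := by rw [hT]; positivity
  obtain ⟨N₀, hN₀⟩ := exists_nat_gt (T / ε)
  refine ⟨max M N₀, fun n hn => ?_⟩
  have hMn : M ≤ max M N₀ := le_max_left _ _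
  have hNpos : (0 : ℝ) < ((max M N₀ : ℕ) : ℝ) + 1 := by positivity
  have hN₀' : T / ε < ((max M N₀ : ℕ) : ℝ) + 1 := by
    have : (N₀ : ℝ) ≤ ((max M N₀ : ℕ) : ℝ) := by exact_mod_cast le_max_right M N₀
    linarith
  rw [Real.dist_eq]
  calc |psum K n - psum K (max M N₀)| ≤ T / (((max M N₀ : ℕ) : ℝ) + 1) := abs_psum_sub_psum_le hE hδ hL h hMn hn
    _ < ε := by
        rw [div_lt_iff₀ hNpos]
        calc T = T / ε * ε := by field_simp
          _ < (((max M N₀ : ℕ) : ℝ) + 1) * ε := mul_lt_mul_of_pos_right hN₀' hε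
          _ = ε * (((max M N₀ : ℕ) : ℝ) + 1) := mul_comm _ _

/-- Hence the partial sums converge to some limit. [folklore] -/
theorem exists_tendsto_psum_of_shellBound (hE : 0 ≤ E) (hδ : 0 < δ) (hL : 0 < Lr)
    (h : ∀ r : ℕ, M ≤ r → ∀ w ∈ annulus 4 r (r + 1),
      |K w| ≤ E / ((r : ℝ) + 1) ^ 4 * Real.exp (-(δ / Lr) * ((r : ℝ) + 1))) :
    ∃ B : ℝ, Tendsto (psum K) atTop (𝓝 B) :=
  cauchySeq_tendsto_of_complete (cauchySeq_psum_of_shellBound hE hδ hL h)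

end Limit

/-- **The full (punctured) lattice sum** `Σ_{w ≠ 0} K(w) := lim_R Σ_{0<‖w‖∞≤R} K(w)` (a junk value if the limit does
not exist; every use below is under a hypothesis that makes it exist). [folklore] -/
def fullSum (K : Pt → ℝ) : ℝ := limUnder atTop (psum K)

/-- If the partial sums converge, they converge to `fullSum K`. [folklore] -/
theorem tendsto_fullSum {K : Pt → ℝ} (h : ∃ B : ℝ, Tendsto (psum K) atTop (𝓝 B)) :
    Tendsto (psum K) atTop (𝓝 (fullSum K)) :=
  tendsto_nhds_limUnder h

/-- If the partial sums converge to `B`, then `fullSum K = B`. [folklore] -/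
theorem fullSum_eq_of_tendsto {K : Pt → ℝ} {B : ℝ} (h : Tendsto (psum K) atTop (𝓝 B)) : fullSum K = B :=
  tendsto_nhds_unique (tendsto_fullSum ⟨B, h⟩) h

section LimitBounds

variable {K : Pt → ℝ} {E δ Lr : ℝ} {M : ℕ}

/-- Under (W3a)'s shellwise bound the partial sums converge to `fullSum K`. [folklore] -/
theorem tendsto_fullSum_of_shellBound (hE : 0 ≤ E) (hδ : 0 < δ) (hL : 0 < Lr)
    (h : ∀ r : ℕ, M ≤ r → ∀ w ∈ annulus 4 r (r + 1),
      |K w| ≤ E / ((r : ℝ) + 1) ^ 4 * Real.exp (-(δ / Lr) * ((r : ℝ) + 1))) :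
    Tendsto (psum K) atTop (𝓝 (fullSum K)) :=
  tendsto_fullSum (exists_tendsto_psum_of_shellBound hE hδ hL h)

/-- **Quantitative rate**: `|fullSum K − psum K R| ≤ 80E(1 + L/δ)/(R+1)` for every `R ≥ M`. [folklore] -/
theorem abs_fullSum_sub_psum_le (hE : 0 ≤ E) (hδ : 0 < δ) (hL : 0 < Lr)
    (h : ∀ r : ℕ, M ≤ r → ∀ w ∈ annulus 4 r (r + 1),
      |K w| ≤ E / ((r : ℝ) + 1) ^ 4 * Real.exp (-(δ / Lr) * ((r : ℝ) + 1)))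
    {R : ℕ} (hMR : M ≤ R) :
    |fullSum K - psum K R| ≤ 80 * E * (1 + Lr / δ) / ((R : ℝ) + 1) := by
  have hlim : Tendsto (fun n => |psum K n - psum K R|) atTop (𝓝 |fullSum K - psum K R|) :=
    ((tendsto_fullSum_of_shellBound hE hδ hL h).sub_const _).abs
  refine le_of_tendsto hlim ?_
  filter_upwards [eventually_ge_atTop R] with n hn
  exact abs_psum_sub_psum_le hE hδ hL h hMR hn

end LimitBounds

/-! ## 3. (W3b) from (W3b′) `|β⁰(L,k) − fullSum K_{L,k}| ≤ U`, and the composites -/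

section Ident

/-- **(W3b′) ⟹ (W3b).**  Under the (W3a) shellwise bound of `WindowInterface.windowDecomposition_of_splitInterface`
(which makes every `fullSum K_{L,k}` exist), the bound `|β⁰(L,k) − fullSum K_{L,k}| ≤ U` gives the interface's
identification binder `∃ R ≥ M(L), |β⁰(L,k) − Σ_{0<‖w‖∞≤R} K_{L,k}| ≤ U + ε`, for any `ε > 0`. [folklore] -/
theorem hident_of_fullSum {β0 : ℕ → ℕ → ℝ} {K : ℕ → ℕ → Pt → ℝ} {E δ U : ℝ} {M : ℕ → ℕ} (hE : 0 ≤ E) (hδ : 0 < δ)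
    (htail : ∀ L : ℕ, 2 ≤ L → ∀ k : ℕ, ∀ r : ℕ, M L ≤ r → ∀ w ∈ annulus 4 r (r + 1),
      |K L k w| ≤ E / ((r : ℝ) + 1) ^ 4 * Real.exp (-(δ / L) * ((r : ℝ) + 1)))
    (hU : ∀ L : ℕ, 2 ≤ L → ∀ k : ℕ, |β0 L k - fullSum (K L k)| ≤ U) {ε : ℝ} (hε : 0 < ε) :
    ∀ L : ℕ, 2 ≤ L → ∀ k : ℕ, ∃ R : ℕ, M L ≤ R ∧ |β0 L k - ∑ w ∈ annulus 4 0 R, K L k w| ≤ U + ε := by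
  intro L hL k
  have hLpos : (0 : ℝ) < (L : ℝ) := by exact_mod_cast (by omega : 0 < L)
  set T : ℝ := 80 * E * (1 + (L : ℝ) / δ) with hT
  have hT0 : 0 ≤ T := by rw [hT]; positivity
  obtain ⟨N₀, hN₀⟩ := exists_nat_gt (T / ε)
  refine ⟨max (M L) N₀, le_max_left _ _, ?_⟩
  have hNpos : (0 : ℝ) < ((max (M L) N₀ : ℕ) : ℝ) + 1 := by positivity
  have hN₀' : T / ε < ((max (M L) N₀ : ℕ) : ℝ) + 1 := by
    have : (N₀ : ℝ) ≤ ((max (M L) N₀ : ℕ) : ℝ) := by exact_mod_cast le_max_right (M L) N₀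
    linarith
  have htailR : |fullSum (K L k) - psum (K L k) (max (M L) N₀)| ≤ ε := by
    calc |fullSum (K L k) - psum (K L k) (max (M L) N₀)| ≤ T / (((max (M L) N₀ : ℕ) : ℝ) + 1) :=
          abs_fullSum_sub_psum_le hE hδ hLpos (htail L hL k) (le_max_left _ _)
      _ ≤ ε := by
          rw [div_le_iff₀ hNpos]
          calc T = T / ε * ε := by field_simp
            _ ≤ (((max (M L) N₀ : ℕ) : ℝ) + 1) * ε := (mul_lt_mul_of_pos_right hN₀' hε).le
            _ = ε * (((max (M L) N₀ : ℕ) : ℝ) + 1) := mul_comm _ _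
  rw [← psum_def]
  calc |β0 L k - psum (K L k) (max (M L) N₀)|
      = |(β0 L k - fullSum (K L k)) + (fullSum (K L k) - psum (K L k) (max (M L) N₀))| := by ring_nf
    _ ≤ |β0 L k - fullSum (K L k)| + |fullSum (K L k) - psum (K L k) (max (M L) N₀)| := abs_add_le _ _
    _ ≤ U + ε := add_le_add (hU L hL k) htailR

/-- **(W3b) ⟹ (W3b′): the reduction loses nothing.**  Conversely, under the same (W3a) shellwise bound AND the
window comparability `1 ≤ M(L)`, `L ≤ c·M(L)` of the wall, the interface's binder `∃ R ≥ M(L), |β⁰(L,k) − Σ_{0<‖w‖∞≤R}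
K_{L,k}| ≤ U` gives back `|β⁰(L,k) − fullSum K_{L,k}| ≤ U + 80E(1 + c/δ)` — so (W3b′) and (W3b) are the same statement
up to the (irrelevant) additive constant of the `A₁` slot. [folklore] -/
theorem fullSumIdent_of_hident {β0 : ℕ → ℕ → ℝ} {K : ℕ → ℕ → Pt → ℝ} {E δ U cc : ℝ} {M : ℕ → ℕ} (hE : 0 ≤ E)
    (hδ : 0 < δ) (hM : ∀ L : ℕ, 2 ≤ L → 1 ≤ M L ∧ (L : ℝ) ≤ cc * M L)
    (htail : ∀ L : ℕ, 2 ≤ L → ∀ k : ℕ, ∀ r : ℕ, M L ≤ r → ∀ w ∈ annulus 4 r (r + 1),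
      |K L k w| ≤ E / ((r : ℝ) + 1) ^ 4 * Real.exp (-(δ / L) * ((r : ℝ) + 1)))
    (hident : ∀ L : ℕ, 2 ≤ L → ∀ k : ℕ, ∃ R : ℕ, M L ≤ R ∧ |β0 L k - ∑ w ∈ annulus 4 0 R, K L k w| ≤ U) :
    ∀ L : ℕ, 2 ≤ L → ∀ k : ℕ, |β0 L k - fullSum (K L k)| ≤ U + 80 * E * (1 + cc / δ) := by
  intro L hL k
  obtain ⟨R, hMR, hU⟩ := hident L hL k
  obtain ⟨hM1, hLM⟩ := hM L hL
  have hLpos : (0 : ℝ) < (L : ℝ) := by exact_mod_cast (by omega : 0 < L)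
  have hcc : 0 ≤ cc := by
    have hM0 : (1 : ℝ) ≤ M L := by exact_mod_cast hM1
    nlinarith
  have hR1 : 1 ≤ R := le_trans hM1 hMR
  have hLR : (L : ℝ) ≤ cc * R := by
    have : (M L : ℝ) ≤ R := by exact_mod_cast hMR
    nlinarith
  -- the limit of the finite tails `|psum n − psum R| ≤ 80E(1 + c/δ)` (`WindowInterface.tail_sum_le` from radius `R`)
  have hlim : Tendsto (fun n => |psum (K L k) n - psum (K L k) R|) atTop (𝓝 |fullSum (K L k) - psum (K L k) R|) :=
    ((tendsto_fullSum_of_shellBound hE hδ hLpos (htail L hL k)).sub_const _).abs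
  have hfull : |fullSum (K L k) - psum (K L k) R| ≤ 80 * E * (1 + cc / δ) := by
    refine le_of_tendsto hlim ?_
    filter_upwards [eventually_ge_atTop R] with n hn
    rw [psum_sub_psum _ hn]
    exact tail_sum_le hE hδ (by omega) hR1 hLR hn fun r hr w hw => htail L hL k r (le_trans hMR hr) w hw
  rw [← psum_def] at hU
  calc |β0 L k - fullSum (K L k)| = |(β0 L k - psum (K L k) R) + (psum (K L k) R - fullSum (K L k))| := by ring_nf
    _ ≤ |β0 L k - psum (K L k) R| + |psum (K L k) R - fullSum (K L k)| := abs_add_le _ _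
    _ ≤ U + 80 * E * (1 + cc / δ) := add_le_add hU (by rwa [abs_sub_comm])

variable {ι : Type*} {s : Finset ι} {c : ι → ℝ} {P Q : ι → Leg}

/-- **THE WALL FROM (W1) + (W2) + (W3a) + (W3b′)**: `WindowInterface.windowDecomposition_of_splitInterface` with the
identification binder replaced by `|β⁰(L,k) − fullSum K_{L,k}| ≤ U`; the constant becomes
`A₁ = (80E(1 + c/δ) + (U + 1)) + 80D`. [folklore] -/
theorem windowDecomposition_of_fullSumInterface (hdeg : ∀ i ∈ s, (P i).a + (Q i).a = 6) {μ ν : Fin 4} {κ : ℝ}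
    (hval : ∀ x : E4, x ≠ 0 → x μ * x ν * contBubble s c P Q x = leadingIntegrand κ μ ν x)
    {β0 : ℕ → ℕ → ℝ} {K : ℕ → ℕ → Pt → ℝ} {D E δ U cc : ℝ} {M : ℕ → ℕ} (hD : 0 ≤ D) (hE : 0 ≤ E) (hδ : 0 < δ)
    (hc : 1 ≤ cc) (hM : ∀ L : ℕ, 2 ≤ L → 1 ≤ M L ∧ (L : ℝ) ≤ cc * M L) (hML : ∀ L : ℕ, 2 ≤ L → M L ≤ L)
    (hin : ∀ L : ℕ, 2 ≤ L → ∀ k : ℕ, ∀ w ∈ annulus 4 0 (M L),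
      |K L k w - toReal w μ * toReal w ν * lattBubble s c P Q L k w| ≤ D / ((supNorm w : ℝ) ^ 2 * (L : ℝ) ^ 2))
    (htail : ∀ L : ℕ, 2 ≤ L → ∀ k : ℕ, ∀ r : ℕ, M L ≤ r → ∀ w ∈ annulus 4 r (r + 1),
      |K L k w| ≤ E / ((r : ℝ) + 1) ^ 4 * Real.exp (-(δ / L) * ((r : ℝ) + 1)))
    (hU : ∀ L : ℕ, 2 ≤ L → ∀ k : ℕ, |β0 L k - fullSum (K L k)| ≤ U) :
    WindowDecomposition β0 (fun w => leadingIntegrand κ μ ν (toReal w)) (|κ| * 24 + |κ| * 110592) (bubbleConst s c P Q)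
      ((80 * E * (1 + cc / δ) + (U + 1)) + 80 * D) cc M :=
  windowDecomposition_of_splitInterface hdeg hval hD hE hδ hc hM hML hin htail (hident_of_fullSum hE hδ htail hU one_pos)

/-- **THE ALL-LEG-LEVEL WALL FROM (W1) + (W2′) + (W3a-leg) + (W3b′)**:
`WindowInterface.windowDecomposition_of_legSplitInterface` with the identification binder replaced by
`|β⁰(L,k) − fullSum (w ↦ w_μw_ν Σ_i c_i F′_i G′_i(L,k;w))| ≤ U` — the full `(1.22)`-moment of the leg-product integrand,
which exists by the leg tails. [folklore] -/
theorem windowDecomposition_of_legFullSumInterface (hdeg : ∀ i ∈ s, (P i).a + (Q i).a = 6) {μ ν : Fin 4} {κ : ℝ}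
    (hval : ∀ x : E4, x ≠ 0 → x μ * x ν * contBubble s c P Q x = leadingIntegrand κ μ ν x)
    {β0 : ℕ → ℕ → ℝ} {F' G' : ι → ℕ → ℕ → Pt → ℝ} {R S R' S' : ι → ℝ} {δ U cc : ℝ} {M : ℕ → ℕ}
    (hR : ∀ i ∈ s, 0 ≤ R i) (hS : ∀ i ∈ s, 0 ≤ S i) (hR' : ∀ i ∈ s, 0 ≤ R' i) (hS' : ∀ i ∈ s, 0 ≤ S' i) (hδ : 0 < δ)
    (hc : 1 ≤ cc) (hM : ∀ L : ℕ, 2 ≤ L → 1 ≤ M L ∧ (L : ℝ) ≤ cc * M L) (hML : ∀ L : ℕ, 2 ≤ L → M L ≤ L)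
    (hF : ∀ L : ℕ, 2 ≤ L → ∀ k : ℕ, ∀ w ∈ annulus 4 0 (M L), ∀ i ∈ s,
      |F' i L k w - (P i).f L k w| ≤ R i / ((supNorm w : ℝ) ^ ((P i).a - 2) * (L : ℝ) ^ 2))
    (hG : ∀ L : ℕ, 2 ≤ L → ∀ k : ℕ, ∀ w ∈ annulus 4 0 (M L), ∀ i ∈ s,
      |G' i L k w - (Q i).f L k w| ≤ S i / ((supNorm w : ℝ) ^ ((Q i).a - 2) * (L : ℝ) ^ 2))
    (hFtail : ∀ L : ℕ, 2 ≤ L → ∀ k : ℕ, ∀ r : ℕ, M L ≤ r → ∀ w ∈ annulus 4 r (r + 1), ∀ i ∈ s,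
      |F' i L k w| ≤ R' i / ((r : ℝ) + 1) ^ (P i).a * Real.exp (-(δ / L) * ((r : ℝ) + 1)))
    (hGtail : ∀ L : ℕ, 2 ≤ L → ∀ k : ℕ, ∀ r : ℕ, M L ≤ r → ∀ w ∈ annulus 4 r (r + 1), ∀ i ∈ s,
      |G' i L k w| ≤ S' i / ((r : ℝ) + 1) ^ (Q i).a)
    (hU : ∀ L : ℕ, 2 ≤ L → ∀ k : ℕ,
      |β0 L k - fullSum (fun w => toReal w μ * toReal w ν * ∑ i ∈ s, c i * (F' i L k w * G' i L k w))| ≤ U) :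
    WindowDecomposition β0 (fun w => leadingIntegrand κ μ ν (toReal w)) (|κ| * 24 + |κ| * 110592) (bubbleConst s c P Q)
      ((80 * (∑ i ∈ s, |c i| * (R' i * S' i)) * (1 + cc / δ) + (U + 1)) +
        80 * ∑ i ∈ s, |c i| * ((((P i).A + (P i).B) * S i + R i * ((Q i).A + (Q i).B) + R i * S i))) cc M := by
  have hE : 0 ≤ ∑ i ∈ s, |c i| * (R' i * S' i) :=
    Finset.sum_nonneg fun i hi => mul_nonneg (abs_nonneg _) (mul_nonneg (hR' i hi) (hS' i hi))
  have htail : ∀ L : ℕ, 2 ≤ L → ∀ k : ℕ, ∀ r : ℕ, M L ≤ r → ∀ w ∈ annulus 4 r (r + 1),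
      |(fun w => toReal w μ * toReal w ν * ∑ i ∈ s, c i * (F' i L k w * G' i L k w)) w| ≤
        (∑ i ∈ s, |c i| * (R' i * S' i)) / ((r : ℝ) + 1) ^ 4 * Real.exp (-(δ / L) * ((r : ℝ) + 1)) :=
    fun L hL k r hr w hw =>
      shellBound_of_legDecay hdeg μ ν hw (Real.exp_pos _).le hR' (fun i hi => hFtail L hL k r hr w hw i hi)
        (fun i hi => hGtail L hL k r hr w hw i hi)
  exact windowDecomposition_of_legSplitInterface hdeg hval hR hS hR' hS' hδ hc hM hML hF hG hFtail hGtail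
    (hident_of_fullSum (K := fun L k w => toReal w μ * toReal w ν * ∑ i ∈ s, c i * (F' i L k w * G' i L k w))
      hE hδ htail hU one_pos)

end Ident

/-! ## 4. `fullSum` is the tree's `tsum` for summable kernels vanishing at the origin; the bridge to (1.22) -/

section Tsum

open Literature.Probability.LatticeModels (box box_mono)
open Literature.MathematicalPhysics.QuantumFieldTheory.Balaban1983to89.Beta.DyadicShell (mem_box_iff supNorm_eq_zero_iff)

/-- Full ball = origin + punctured ball: `Σ_{‖w‖∞≤R} K = K 0 + psum K R` (the ball of sup-radius `0` is the origin —
the tree's `CTWSAW.box_four_zero`, re-derived inline to keep this module's imports inside the Beta tree). [folklore] -/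
theorem sum_box_eq (K : Pt → ℝ) (R : ℕ) : ∑ w ∈ box 4 R, K w = K 0 + psum K R := by
  have hsub : box 4 0 ⊆ box 4 R := box_mono 4 (Nat.zero_le R)
  have h0 : box 4 0 = {0} := by
    ext w
    rw [mem_box_iff, Finset.mem_singleton, Nat.le_zero, supNorm_eq_zero_iff]
  rw [psum, Literature.Probability.LatticeModels.annulus, ← Finset.sum_sdiff hsub, h0, Finset.sum_singleton, add_comm]

/-- The balls `box 4 R` exhaust `ℤ⁴` (tend to `atTop` in `Finset ℤ⁴`). [folklore] -/
theorem tendsto_box_atTop : Tendsto (box 4) atTop atTop :=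
  tendsto_atTop_finset_of_monotone (box_mono 4) fun w => ⟨supNorm w, mem_box_iff.mpr le_rfl⟩

/-- The punctured partial sums of a summable kernel converge to `Σ' w, K w − K 0`. [folklore] -/
theorem tendsto_psum_of_summable (K : Pt → ℝ) (hK : Summable K) :
    Tendsto (psum K) atTop (𝓝 ((∑' w, K w) - K 0)) := by
  have h1 : Tendsto (fun R => ∑ w ∈ box 4 R, K w) atTop (𝓝 (∑' w, K w)) := hK.hasSum.comp tendsto_box_atTop
  have e : psum K = fun R => (∑ w ∈ box 4 R, K w) - K 0 := funext fun R => by rw [sum_box_eq]; ring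
  rw [e]
  exact h1.sub_const _

/-- **For a summable kernel the punctured full sum is the `tsum` minus the origin**: `fullSum K = Σ' w, K w − K 0`.
[folklore] -/
theorem fullSum_eq_tsum_sub (K : Pt → ℝ) (hK : Summable K) : fullSum K = (∑' w, K w) - K 0 :=
  fullSum_eq_of_tendsto (tendsto_psum_of_summable K hK)

/-- In particular a summable kernel has convergent punctured partial sums. [folklore] -/
theorem exists_tendsto_psum_of_summable (K : Pt → ℝ) (hK : Summable K) : ∃ B, Tendsto (psum K) atTop (𝓝 B) :=
  ⟨_, tendsto_psum_of_summable K hK⟩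

/-- **THE BRIDGE TO (1.22).**  For a kernel `Π` on `ℤ⁴` whose `(1.22)` integrand `x ↦ Π_{μν}(x)x_μx_ν` is summable
(e.g. under the (5.10)-type exponential decay, `Beta.PolarizationSign.momentSummable_of_decay510`), the tree's typed
right member of (1.22), `B12Beta.secondMoment Π μ ν = Σ' x, Π_{μν}(x)x_μx_ν`, IS the punctured full sum of that
integrand — the origin carries the weight `0`. So (W3b′) for Bałaban's `β⁰ = secondMoment Π` reads: the second moment of
`Π` minus the full second moment of its leg-product part is `(L,k)`-bounded. [folklore] -/
theorem secondMoment_eq_fullSum (P : B12Beta.Kernel 4) (μ ν : Fin 4)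
    (hK : Summable fun x : Pt => P μ ν x * (x μ : ℝ) * (x ν : ℝ)) :
    B12Beta.secondMoment P μ ν = fullSum (fun x : Pt => P μ ν x * (x μ : ℝ) * (x ν : ℝ)) := by
  rw [fullSum_eq_tsum_sub _ hK, B12Beta.secondMoment]
  simp

/-- The same with the interface's weight convention `w_μw_ν·Π(w)` (`DyadicShell.toReal`). [folklore] -/
theorem secondMoment_eq_fullSum' (P : B12Beta.Kernel 4) (μ ν : Fin 4)
    (hK : Summable fun x : Pt => P μ ν x * (x μ : ℝ) * (x ν : ℝ)) :
    B12Beta.secondMoment P μ ν = fullSum (fun w : Pt => toReal w μ * toReal w ν * P μ ν w) := by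
  rw [secondMoment_eq_fullSum P μ ν hK]
  congr 1
  funext w
  simp only [toReal]
  ring

end Tsum

/-! ## 5. The algebra of (W3b′) for kernels assembled from pieces -/

section Pieces

/-- `fullSum` is additive on kernels with convergent partial sums. [folklore] -/
theorem fullSum_add {K₁ K₂ : Pt → ℝ} (h₁ : ∃ B, Tendsto (psum K₁) atTop (𝓝 B)) (h₂ : ∃ B, Tendsto (psum K₂) atTop (𝓝 B)) :
    fullSum (fun w => K₁ w + K₂ w) = fullSum K₁ + fullSum K₂ := by
  refine fullSum_eq_of_tendsto ?_
  have e : psum (fun w => K₁ w + K₂ w) = fun R => psum K₁ R + psum K₂ R := funext (psum_add K₁ K₂)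
  rw [e]
  exact (tendsto_fullSum h₁).add (tendsto_fullSum h₂)

/-- The partial sums of a sum converge if those of the summands do. [folklore] -/
theorem exists_tendsto_psum_add {K₁ K₂ : Pt → ℝ} (h₁ : ∃ B, Tendsto (psum K₁) atTop (𝓝 B))
    (h₂ : ∃ B, Tendsto (psum K₂) atTop (𝓝 B)) : ∃ B, Tendsto (psum (fun w => K₁ w + K₂ w)) atTop (𝓝 B) := by
  obtain ⟨B₁, hB₁⟩ := h₁
  obtain ⟨B₂, hB₂⟩ := h₂
  refine ⟨B₁ + B₂, ?_⟩
  have e : psum (fun w => K₁ w + K₂ w) = fun R => psum K₁ R + psum K₂ R := funext (psum_add K₁ K₂)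
  rw [e]
  exact hB₁.add hB₂

/-- `fullSum` is homogeneous on kernels with convergent partial sums. [folklore] -/
theorem fullSum_const_mul (a : ℝ) {K : Pt → ℝ} (h : ∃ B, Tendsto (psum K) atTop (𝓝 B)) :
    fullSum (fun w => a * K w) = a * fullSum K := by
  refine fullSum_eq_of_tendsto ?_
  have e : psum (fun w => a * K w) = fun R => a * psum K R := funext (psum_const_mul a K)
  rw [e]
  exact (tendsto_fullSum h).const_mul a

/-- A finitely supported kernel (vanishing beyond sup-radius `R₁`) has convergent partial sums … [folklore] -/
theorem tendsto_psum_of_support {K : Pt → ℝ} {R₁ : ℕ} (hK : ∀ w : Pt, R₁ < supNorm w → K w = 0) :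
    Tendsto (psum K) atTop (𝓝 (psum K R₁)) := by
  refine tendsto_const_nhds.congr' ?_
  filter_upwards [eventually_ge_atTop R₁] with R hR
  exact (psum_eq_of_support hK hR).symm

/-- … and its full sum IS the finite partial sum `Σ_{0<‖w‖∞≤R₁} K` (the CONTACT-table case:
`Beta.BubbleTable.contact_stencil` is supported in `‖w‖∞ ≤ 3`). [folklore] -/
theorem fullSum_of_support {K : Pt → ℝ} {R₁ : ℕ} (hK : ∀ w : Pt, R₁ < supNorm w → K w = 0) :
    fullSum K = ∑ w ∈ annulus 4 0 R₁, K w :=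
  fullSum_eq_of_tendsto (tendsto_psum_of_support hK)

/-- The finite partial sum of a finitely supported piece is bounded by its coefficient table times the weight bound:
if `|K w| ≤ A` on `0 < ‖w‖∞ ≤ R₁` then `|fullSum K| ≤ #(annulus 4 0 R₁)·A`. [folklore] -/
theorem abs_fullSum_le_of_support {K : Pt → ℝ} {R₁ : ℕ} {A : ℝ} (hK : ∀ w : Pt, R₁ < supNorm w → K w = 0)
    (hA : ∀ w ∈ annulus 4 0 R₁, |K w| ≤ A) : |fullSum K| ≤ (annulus 4 0 R₁).card * A := by
  rw [fullSum_of_support hK]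
  calc |∑ w ∈ annulus 4 0 R₁, K w| ≤ ∑ w ∈ annulus 4 0 R₁, |K w| := Finset.abs_sum_le_sum_abs _ _
    _ ≤ ∑ _w ∈ annulus 4 0 R₁, A := Finset.sum_le_sum hA
    _ = (annulus 4 0 R₁).card * A := by rw [Finset.sum_const, nsmul_eq_mul]

/-- **(W3b′) FROM PIECES.**  If `β⁰(L,k) = fullSum K_{L,k} + fullSum C_{L,k} + ρ(L,k)` with `C_{L,k}` a piece kept OUT
of the leg-product integrand (e.g. the contact table) obeying `|fullSum C_{L,k}| ≤ U_C` and a remainder `|ρ(L,k)| ≤ U_ρ`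
(unit-sector pieces, minimizer-dressing cross terms), then `|β⁰(L,k) − fullSum K_{L,k}| ≤ U_C + U_ρ`. [folklore] -/
theorem ident_of_pieces {β0 : ℕ → ℕ → ℝ} {K C : ℕ → ℕ → Pt → ℝ} {ρ : ℕ → ℕ → ℝ} {UC Uρ : ℝ}
    (hβ : ∀ L : ℕ, 2 ≤ L → ∀ k : ℕ, β0 L k = fullSum (K L k) + fullSum (C L k) + ρ L k)
    (hC : ∀ L : ℕ, 2 ≤ L → ∀ k : ℕ, |fullSum (C L k)| ≤ UC) (hρ : ∀ L : ℕ, 2 ≤ L → ∀ k : ℕ, |ρ L k| ≤ Uρ) :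
    ∀ L : ℕ, 2 ≤ L → ∀ k : ℕ, |β0 L k - fullSum (K L k)| ≤ UC + Uρ := by
  intro L hL k
  rw [hβ L hL k]
  calc |fullSum (K L k) + fullSum (C L k) + ρ L k - fullSum (K L k)| = |fullSum (C L k) + ρ L k| := by ring_nf
    _ ≤ |fullSum (C L k)| + |ρ L k| := abs_add_le _ _
    _ ≤ UC + Uρ := add_le_add (hC L hL k) (hρ L hL k)

/-- The origin never matters: the `(1.22)` weight `w_μw_ν` vanishes at `w = 0`, so a kernel of the form
`w ↦ w_μw_ν·Π(w)` summed over the punctured balls loses nothing of Bałaban's `Σ_x`. [folklore] -/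
theorem weight_zero (μ ν : Fin 4) (Pi : Pt → ℝ) : toReal 0 μ * toReal 0 ν * Pi 0 = 0 := by
  simp [toReal]

end Pieces

end

end Literature.MathematicalPhysics.QuantumFieldTheory.Balaban1983to89.Beta.WindowIdentification
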